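import Mathlib
import HarnessLib

/-!
# Route `PoloidalWindowDoor`, crux `PoloidalWindowRigidity` (stmt-19708), line `sparse_energy` (cstrat g11) —
# stub S1 `stub_scaledEnergy`, near-apex bootstrap: POWER-LAW time weights and the DYADIC shell sums

Seat ns-poloidal-K2-p2 g9 (successor of the interim LEAD-of-record on 19708; file `--supports`).  Companion of `…SparseEnergyTimeWeights`.
The rounds of the near-apex bootstrap are cleanest with POWER-LAW envelopes `E(a,ρ,t) ≤ K_γ ρ (ρ²/(−t))^γ` on the near regime `−t ≤ ρ²`
(γ = 1 trivial; after round 1 weaken `√x + log x + 1 ≤ c x^{5/8}` for `x = ρ²/(−t₀) ≥ 1`; then γ: 5/8 → 1/8 → 0, every time integral a pure power —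
CENSUS-19708-K2p2-g9 §5.0 / S1-NEAR-DESIGN §2, power-law variant).  This file provides the two generic sums/integrals those rounds consume:

* `integral_neg_rpow` — `∫_s^{t₀} (−t)^{−β} dt = ((−s)^{1−β} − (−t₀)^{1−β})/(1−β)` for `β ≠ 1`, `s < t₀ < 0`, with the one-sided corollaries
  `integral_neg_rpow_le_of_lt_one` (`β < 1`: `≤ (−s)^{1−β}/(1−β)`) and `integral_neg_rpow_le_of_one_lt` (`β > 1`: `≤ (−t₀)^{1−β}/(β−1)`);
* `tsum_dyadic_shell` — `Σ_k (2^k)^{−4} (2^{k+1})^{p} = 2^p / (1 − 2^{p−4})` for real `p < 4` (the far-field pressure sum against a power envelope),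
  and `log_le_rpow_div` — `log x ≤ x^ε/ε` for `x > 0`, `ε > 0` (the round-1 logarithm absorbed into a power).

WHAT THIS IS NOT: not a claim about Navier–Stokes — calculus (bears_on LADDER-NS N0 via crux 19708, line sparse_energy, stub S1). [folklore]
-/

noncomputable section

-- the summit and its single sub-problem share the name (CONVENTIONS §1), as in every Theorems file
set_option linter.dupNamespace false

namespace Summit.NavierStokesRegularity.NavierStokesRegularity.Theorems.PoloidalWindowDoorPoloidalWindowRigiditySparseEnergyPowerWeights

open MeasureTheory Set intervalIntegral

/-! ### Power-law time weights -/

/-- `d/dt [−(−t)^{1−β}/(1−β)] = (−t)^{−β}` on `t < 0` (`β ≠ 1`). [folklore] -/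
theorem hasDerivAt_neg_rpow_prim {β : ℝ} (hβ : β ≠ 1) {t : ℝ} (ht : t < 0) :
    HasDerivAt (fun τ : ℝ => -((-τ) ^ (1 - β)) / (1 - β)) ((-t) ^ (-β)) t := by
  have hnt : 0 < -t := neg_pos.2 ht
  have h1 : HasDerivAt (fun τ : ℝ => (-τ) ^ (1 - β)) ((-1) * (1 - β) * (-t) ^ (1 - β - 1)) t := by
    have h := (hasDerivAt_neg t).rpow_const (p := 1 - β) (Or.inl hnt.ne')
    simpa [mul_comm] using h
  have h2 := (h1.neg).div_const (1 - β)
  refine h2.congr_deriv ?_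
  have h1β : (1 - β) ≠ 0 := sub_ne_zero.2 (Ne.symm hβ)
  rw [show (1 - β - 1) = -β by ring]
  field_simp

/-- **`∫_s^{t₀} (−t)^{−β} dt = ((−s)^{1−β} − (−t₀)^{1−β})/(1−β)`** for `β ≠ 1`, `s < t₀ < 0`. [folklore] -/
theorem integral_neg_rpow {β : ℝ} (hβ : β ≠ 1) {s t₀ : ℝ} (hst : s < t₀) (ht₀ : t₀ < 0) :
    ∫ t in s..t₀, (-t) ^ (-β) = ((-s) ^ (1 - β) - (-t₀) ^ (1 - β)) / (1 - β) := by
  have hderiv : ∀ t ∈ uIcc s t₀, HasDerivAt (fun τ : ℝ => -((-τ) ^ (1 - β)) / (1 - β)) ((-t) ^ (-β)) t := by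
    intro t ht; rw [uIcc_of_le hst.le] at ht; exact hasDerivAt_neg_rpow_prim hβ (lt_of_le_of_lt ht.2 ht₀)
  have hcont : ContinuousOn (fun t : ℝ => (-t) ^ (-β)) (uIcc s t₀) := by
    rw [uIcc_of_le hst.le]
    refine fun t ht => ((continuous_neg.continuousAt).rpow_const (Or.inl ?_)).continuousWithinAt
    exact (neg_pos.2 (lt_of_le_of_lt ht.2 ht₀)).ne'
  rw [integral_eq_sub_of_hasDerivAt hderiv hcont.intervalIntegrable]
  ring

/-- `β < 1`: `∫_s^{t₀} (−t)^{−β} ≤ (−s)^{1−β}/(1−β)`. [folklore] -/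
theorem integral_neg_rpow_le_of_lt_one {β : ℝ} (hβ : β < 1) {s t₀ : ℝ} (hst : s < t₀) (ht₀ : t₀ < 0) :
    ∫ t in s..t₀, (-t) ^ (-β) ≤ (-s) ^ (1 - β) / (1 - β) := by
  rw [integral_neg_rpow hβ.ne hst ht₀]
  have h1 : 0 < 1 - β := sub_pos.2 hβ
  have h2 : 0 ≤ (-t₀) ^ (1 - β) := Real.rpow_nonneg (neg_pos.2 ht₀).le _
  rw [div_le_div_iff_of_pos_right h1]
  linarith

/-- `β > 1`: `∫_s^{t₀} (−t)^{−β} ≤ (−t₀)^{1−β}/(β−1)`. [folklore] -/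
theorem integral_neg_rpow_le_of_one_lt {β : ℝ} (hβ : 1 < β) {s t₀ : ℝ} (hst : s < t₀) (ht₀ : t₀ < 0) :
    ∫ t in s..t₀, (-t) ^ (-β) ≤ (-t₀) ^ (1 - β) / (β - 1) := by
  rw [integral_neg_rpow hβ.ne' hst ht₀]
  have h1 : 0 < β - 1 := sub_pos.2 hβ
  have h2 : 0 ≤ (-s) ^ (1 - β) := Real.rpow_nonneg (by linarith : (0 : ℝ) ≤ -s) _
  have e : ((-s) ^ (1 - β) - (-t₀) ^ (1 - β)) / (1 - β) = ((-t₀) ^ (1 - β) - (-s) ^ (1 - β)) / (β - 1) := by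
    rw [← neg_sub β 1, div_neg, neg_sub, ← neg_div, neg_sub]
  rw [e, div_le_div_iff_of_pos_right h1]
  linarith

/-! ### The logarithm absorbed into a power, and the dyadic shell sum -/

/-- `log x ≤ x^ε/ε` for `x > 0`, `ε > 0`. [folklore] -/
theorem log_le_rpow_div {x ε : ℝ} (hx : 0 < x) (hε : 0 < ε) : Real.log x ≤ x ^ ε / ε := by
  have h := Real.log_le_sub_one_of_pos (Real.rpow_pos_of_pos hx ε)
  rw [Real.log_rpow hx] at h
  rw [le_div_iff₀ hε]
  nlinarith

/-- **The dyadic shell sum against a power envelope**: for real `p < 4`,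
`Σ_k ((2:ℝ)^k)⁻⁴ · (2^(k+1))^p = 2^p / (1 − 2^(p−4))` (geometric series with ratio `2^{p−4} < 1`). [folklore] -/
theorem tsum_dyadic_shell {p : ℝ} (hp : p < 4) :
    HasSum (fun k : ℕ => (((2 : ℝ) ^ k) ^ (4 : ℝ))⁻¹ * ((2 : ℝ) ^ (k + 1)) ^ p) ((2 : ℝ) ^ p / (1 - (2 : ℝ) ^ (p - 4))) := by
  have hq0 : 0 ≤ (2 : ℝ) ^ (p - 4) := Real.rpow_nonneg zero_le_two _
  have hq1 : (2 : ℝ) ^ (p - 4) < 1 := Real.rpow_lt_one_of_one_lt_of_neg one_lt_two (by linarith)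
  have hgeom := hasSum_geometric_of_lt_one hq0 hq1
  have hmul := hgeom.mul_left ((2 : ℝ) ^ p)
  rw [← div_eq_mul_inv] at hmul
  refine hmul.congr_fun fun k => ?_
  -- `2^p · (2^(p−4))^k = (2^k)^{−4} · (2^(k+1))^p`
  have h2 : (0 : ℝ) < 2 := two_pos
  have h2k : (0 : ℝ) < (2 : ℝ) ^ k := pow_pos h2 k
  rw [← Real.rpow_natCast (2 : ℝ) k, ← Real.rpow_natCast (2 : ℝ) (k + 1)] 
  rw [← Real.rpow_mul h2.le, ← Real.rpow_mul h2.le, ← Real.rpow_neg h2.le, ← Real.rpow_natCast ((2 : ℝ) ^ (p - 4)) k,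
    ← Real.rpow_mul h2.le, ← Real.rpow_add h2, ← Real.rpow_add h2]
  congr 1
  push_cast
  ring

end Summit.NavierStokesRegularity.NavierStokesRegularity.Theorems.PoloidalWindowDoorPoloidalWindowRigiditySparseEnergyPowerWeights

end
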